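import Mathlib
import Summits.ResolutionOfSingularities.ResolutionOfSingularities.Theorems.HomologicalConductorPersistenceSurfaceSaturationRegularSequenceExt
import Summits.ResolutionOfSingularities.ResolutionOfSingularities.Theorems.HomologicalConductorPersistenceCompletionAscentHolds
import Summits.ResolutionOfSingularities.ResolutionOfSingularities.Theorems.HomologicalConductorPersistenceFaithfullyFlatDescentCompletion
import Summits.ResolutionOfSingularities.ResolutionOfSingularities.Theorems.HomologicalConductorPersistenceCompletionIsolatedTransfer
import Summits.ResolutionOfSingularities.ResolutionOfSingularities.Theorems.HomologicalConductorPersistencePeriodicSaturationStage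
import Literature.AlgebraicGeometry.Resolution.NormalAscentCompletion
import Literature.AlgebraicGeometry.Resolution.AdicCompletionRegular
import HarnessLib

/-!
# Rung S-2 `PersistenceSurface` (stmt-ResolutionOfSingularities-19970) — the COMPLETION DOOR for the saturation
# `Sat_N`: `ca(T̂) = caᴺ(T̂) ⇒ ca(T) = caᴺ(T)`, and the Gorenstein / complete-intersection input read on `T̂`

Route `ResolutionOfSingularities/HomologicalConductor`, chain W4.4b, rung S-2 `PersistenceSurface`
(stmt-ResolutionOfSingularities-19970), registered skeleton 1a77c002, stub
`stub_saturationFourSurfaceResidualFour : SaturationFourSurfaceResidual₄`.  [OURS · bookkeeping over LANDED tree lemmas +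
pure commutative algebra; AI-written, weaker than expert review; NOT a statement of the manuscript under study (Hironaka
2017) and no statement of that manuscript is used.]  DEF-FREE; `--supports` only.

The exemptions of the saturation stub landed so far (Gorenstein stages, p794975; complete intersections of any
codimension, p807481) are phrased on the STAGE `T` itself.  Singularity theory presents a surface point by its COMPLETE
local ring (`T̂ ≅ k'⟦x₁,…,x_e⟧/(f₁,…,f_{e−2})` for a complete intersection; the specimen charts of the line card are known
in this form).  Both halves of [Bahlekeh–Hakimian–Salarian–Takahashi, Thm. 4.5] are PROVED in the tree — descent
`caⁿ(T̂) ∩ T ⊆ caⁿ(T)` (`caCompletion_comap_le_holds`, p512917) and ascent `caⁿ(T) ⊆ caⁿ⁺ᵈ(T̂) ∩ T` for `T̂` an isolated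
singularity (`le_caCompletion_comap_holds`) — so saturation DESCENDS from the completion at the same level:

* `cohomologyAnnihilator_le_caAt_of_completion` — `T` noetherian local of dimension `d`, `T̂` an isolated singularity,
  `caⁿ(T̂) ⊆ caᴺ(T̂)` for all `n ≥ N` ⇒ `ca(T) ⊆ caᴺ(T)`;  `cohomologyAnnihilator_eq_caAt_of_completion` (equality);
* `cohomologyAnnihilator_eq_three_of_completion_ext_eq_zero` — `Sat₃(T)` from a GORENSTEIN COMPLETION:
  `Extⁱ_{T̂}(W, T̂) = 0` (`i ≥ 3`, `W` f.g.), `T̂` a domain and an isolated singularity (hand-2's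
  `cohomologyAnnihilatorOfDegree_eq_three_of_ext_eq_zero` on `T̂`, p794975);
* `cohomologyAnnihilator_eq_three_of_completion_ringEquiv_ofList` — `Sat₃(T)` when `T̂` is PRESENTED as a complete
  intersection `S ⧸ (f₁,…,f_c)`, `S` regular local of dimension `2 + c`, `fᵢ ∈ 𝔪_S`, `dim T = 2` (equation count,
  `ext_ofList_eq_zero_of_ringKrullDim_quotient_eq`, p807481/its append; `dim T̂ = dim T`);
* route vocabulary: `ca_subset_caAt_of_completion_ext_eq_zero`, `ca_subset_caAt_of_completion_ringEquiv_ofList` — at a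
  NORMAL stage `↥T ⊆ K` essentially of finite type over `k`, of Krull dimension `2`, which is an isolated singularity
  (every normal surface stage), `ca T ⊆ caAt n T` (`n ≥ 3`) as soon as `T̂` is Gorenstein, resp. presented as a complete
  intersection; `T̂` is a domain by Stacks 0C23 (`IsGRing.isDomain_and_isIntegrallyClosed_adicCompletion`, e.f.t. ⇒ G-ring)
  and an isolated singularity by `isIsolatedSingularity_adicCompletion_of_essFiniteType`.

Net effect on the by-name chain: the (NG) hypothesis of the door of record (`…PersistenceSurfaceDoorNonGorenstein`) may be
checked on the COMPLETED local ring of the stage; it is idle wherever `T̂_m` is Gorenstein — in particular at every normal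
surface stage analytically isomorphic to a complete intersection.

References: A. Bahlekeh, E. Hakimian, S. Salarian, R. Takahashi, Q. J. Math. 67 (2016), Thm. 4.5
[`BahlekehHakimianSalarianTakahashi2015`]; W. Bruns, J. Herzog, *Cohen–Macaulay rings*, Lemma 3.1.16, Thm. 3.3.10
[`BrunsHerzog1998`]; The Stacks project, Tag 0C23 [`StacksProject`] — all used only through landed tree lemmas.
-/

noncomputable section

-- single-problem summit: the doubled namespace component `ResolutionOfSingularities` is forced
set_option linter.dupNamespace false

namespace Summit.ResolutionOfSingularities.ResolutionOfSingularities.Theorems.HomologicalConductor.PersistenceSurfaceSaturationCompletionGorenstein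

open CategoryTheory CategoryTheory.Abelian IsLocalRing Literature.RingTheory.CohomologyAnnihilator
open Literature.AlgebraicGeometry.Resolution
open Summit.ResolutionOfSingularities.ResolutionOfSingularities.Theorems.HomologicalConductor.CompletionAscentHolds
  (le_caCompletion_comap_holds)
open Summit.ResolutionOfSingularities.ResolutionOfSingularities.Theorems.HomologicalConductor.PersistenceFaithfullyFlatDescentCompletion
  (caCompletion_comap_le_holds)
open Summit.ResolutionOfSingularities.ResolutionOfSingularities.Theorems.HomologicalConductor.PersistenceSurfaceSaturationGorenstein
open Summit.ResolutionOfSingularities.ResolutionOfSingularities.Theorems.HomologicalConductor.PersistenceSurfaceSaturationRegularSequenceExt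
open Summit.ResolutionOfSingularities.ResolutionOfSingularities.Theorems.HomologicalConductor.CompletionIsolatedTransfer
open Summit.ResolutionOfSingularities.ResolutionOfSingularities.Theorems.HomologicalConductor.PeriodicSaturationStage
  (ca_subset_caAt_of_le)

universe u

/-! ## Saturation descends from the completion -/

section Descent

variable {R : Type u} [CommRing R] [IsNoetherianRing R] [IsLocalRing R]

/-- **Saturation descends from the completion, level by level.**  For a noetherian local ring `R` of Krull dimension
`d` whose completion `R̂` is an isolated singularity: if `caⁿ(R̂) ⊆ caᴺ(R̂)` for every `n ≥ N`, then `ca(R) ⊆ caᴺ(R)`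
— `x ∈ caⁿ(R) ⊆ caⁿ⁺ᵈ(R̂) ∩ R` (ascent, BHST 4.5 (2)) `⊆ caⁿ⁺ᵈ⁺ᴺ(R̂) ∩ R ⊆ caᴺ(R̂) ∩ R ⊆ caᴺ(R)` (descent, BHST 4.5 (1)).
[cite: BahlekehHakimianSalarianTakahashi2015, Thm. 4.5] -/
theorem cohomologyAnnihilator_le_caAt_of_completion {d : ℕ} (hd : ringKrullDim R = d)
    (hiso : IsIsolatedSingularity (AdicCompletion (maximalIdeal R) R)) {N : ℕ}
    (hsat : ∀ n : ℕ, N ≤ n → cohomologyAnnihilatorOfDegree (AdicCompletion (maximalIdeal R) R) n ≤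
      cohomologyAnnihilatorOfDegree (AdicCompletion (maximalIdeal R) R) N) :
    cohomologyAnnihilator R ≤ cohomologyAnnihilatorOfDegree R N := by
  intro x hx
  obtain ⟨n, hn⟩ := mem_cohomologyAnnihilator_iff.mp hx
  have h1 := le_caCompletion_comap_holds R d hd hiso n hn
  rw [Ideal.mem_comap] at h1
  have h2 : algebraMap R (AdicCompletion (maximalIdeal R) R) x ∈
      cohomologyAnnihilatorOfDegree (AdicCompletion (maximalIdeal R) R) N :=
    hsat (n + d + N) (by omega) (cohomologyAnnihilatorOfDegree_mono (by omega) h1)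
  exact caCompletion_comap_le_holds R N (Ideal.mem_comap.mpr h2)

/-- **`ca(R) = caᴺ(R)` from `ca(R̂) = caᴺ(R̂)`** (levelled form `caⁿ(R̂) = caᴺ(R̂)`, `n ≥ N`), `R̂` an isolated
singularity. [cite: BahlekehHakimianSalarianTakahashi2015, Thm. 4.5] -/
theorem cohomologyAnnihilator_eq_caAt_of_completion {d : ℕ} (hd : ringKrullDim R = d)
    (hiso : IsIsolatedSingularity (AdicCompletion (maximalIdeal R) R)) {N : ℕ}
    (hsat : ∀ n : ℕ, N ≤ n → cohomologyAnnihilatorOfDegree (AdicCompletion (maximalIdeal R) R) n =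
      cohomologyAnnihilatorOfDegree (AdicCompletion (maximalIdeal R) R) N) :
    cohomologyAnnihilator R = cohomologyAnnihilatorOfDegree R N :=
  le_antisymm (cohomologyAnnihilator_le_caAt_of_completion hd hiso fun n hn => (hsat n hn).le)
    (cohomologyAnnihilatorOfDegree_le N)

/-- **`Sat₃(R)` from a GORENSTEIN COMPLETION.**  `R` noetherian local of dimension `d`, `R̂` a domain and an isolated
singularity with `Extⁱ_{R̂}(W, R̂) = 0` for all finitely generated `W` and all `i ≥ 3` ⇒ `ca(R) = ca³(R)`
(`cohomologyAnnihilatorOfDegree_eq_three_of_ext_eq_zero` on `R̂`, then descent).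
[cite: BahlekehHakimianSalarianTakahashi2015, Thm. 4.5; BrunsHerzog1998, Thm. 3.3.10] -/
theorem cohomologyAnnihilator_eq_three_of_completion_ext_eq_zero {d : ℕ} (hd : ringKrullDim R = d)
    (hiso : IsIsolatedSingularity (AdicCompletion (maximalIdeal R) R))
    [IsDomain (AdicCompletion (maximalIdeal R) R)]
    (hGor : ∀ (W : ModuleCat.{u} (AdicCompletion (maximalIdeal R) R)),
      Module.Finite (AdicCompletion (maximalIdeal R) R) W → ∀ i : ℕ, 3 ≤ i →
        ∀ e : Ext.{u} W (ModuleCat.of (AdicCompletion (maximalIdeal R) R) (AdicCompletion (maximalIdeal R) R)) i,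
          e = 0) :
    cohomologyAnnihilator R = cohomologyAnnihilatorOfDegree R 3 := by
  haveI : IsNoetherianRing (AdicCompletion (maximalIdeal R) R) := isNoetherianRing_adicCompletion_maximalIdeal R
  exact cohomologyAnnihilator_eq_caAt_of_completion hd hiso fun n hn =>
    cohomologyAnnihilatorOfDegree_eq_three_of_ext_eq_zero hGor hn

/-- **`Sat₃(R)` when the COMPLETION is PRESENTED as a complete intersection.**  `R` noetherian local of Krull dimension
`2`, `R̂` an isolated singularity, `e : R̂ ≃+* S ⧸ (rs)` with `S` regular local of dimension `2 + rs.length` and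
`rs ⊆ 𝔪_S` ⇒ `ca(R) = ca³(R)` (equation count: `dim S ⧸ (rs) = dim R̂ = dim R = 2`; `R̂` is a domain because `S ⧸ (rs)` is
one — required as an instance on the presentation). [cite: BahlekehHakimianSalarianTakahashi2015, Thm. 4.5; BrunsHerzog1998, Lemma 3.1.16, Thm. 3.3.10] -/
theorem cohomologyAnnihilator_eq_three_of_completion_ringEquiv_ofList (hd : ringKrullDim R = (2 : ℕ))
    (hiso : IsIsolatedSingularity (AdicCompletion (maximalIdeal R) R)) {S : Type u} [CommRing S]
    [IsRegularLocalRing S] (rs : List S) (hmem : ∀ x ∈ rs, x ∈ maximalIdeal S)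
    (hS : ringKrullDim S = (2 + rs.length : ℕ)) [IsDomain (S ⧸ Ideal.ofList rs)]
    (e : AdicCompletion (maximalIdeal R) R ≃+* S ⧸ Ideal.ofList rs) :
    cohomologyAnnihilator R = cohomologyAnnihilatorOfDegree R 3 := by
  haveI : IsDomain (AdicCompletion (maximalIdeal R) R) := MulEquiv.isDomain (S ⧸ Ideal.ofList rs) e.toMulEquiv
  have hq : ringKrullDim (S ⧸ Ideal.ofList rs) = (2 : ℕ) := by
    rw [← ringKrullDim_eq_of_ringEquiv e, ringKrullDim_adicCompletion, hd]
  exact cohomologyAnnihilator_eq_three_of_completion_ext_eq_zero hd hiso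
    (ext_eq_zero_of_ringEquiv e fun W hW i hi x =>
      ext_ofList_eq_zero_of_ringKrullDim_quotient_eq (d := 2) rs hmem hS hq W hW hi x)

end Descent

/-! ## Route vocabulary: the (NG) input read on the completion of a normal surface stage -/

section Stage

variable {k K : Type u} [Field k] [Field K] [Algebra k K]

/-- **The completion of a normal stage essentially of finite type over a field is a domain** (Stacks 0C23 through the
tree: e.f.t. ⇒ G-ring, `isGRing_of_essFiniteType`; normal local G-ring ⇒ analytically normal,
`IsGRing.isDomain_and_isIntegrallyClosed_adicCompletion`). [cite: StacksProject, Tag 0C23] -/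
theorem isDomain_adicCompletion_of_isIntegrallyClosed (T : Subalgebra k K) [IsNoetherianRing ↥T]
    [IsLocalRing ↥T] [IsIntegrallyClosed ↥T] (hT : Algebra.EssFiniteType k ↥T) :
    IsDomain (AdicCompletion (maximalIdeal ↥T) ↥T) :=
  ((isGRing_of_essFiniteType k ↥T hT).isDomain_and_isIntegrallyClosed_adicCompletion).1

/-- **`Satₙ` (`n ≥ 3`) at a normal surface stage whose COMPLETION is Gorenstein**, route vocabulary: for a normal local
stage `↥T ⊆ K`, essentially of finite type over `k`, of Krull dimension `d`, an isolated singularity, with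
`Extⁱ_{T̂}(W, T̂) = 0` for all finitely generated `W` and `i ≥ 3`: `ca T ⊆ caAt n T` — in particular the `m`-th conjunct
`ca ⊆ caAt 4` of `SaturationFourSurfaceResidual₄` and the (NG) hypothesis of `…PersistenceSurfaceDoorNonGorenstein` are
idle there. [cite: BahlekehHakimianSalarianTakahashi2015, Thm. 4.5; BrunsHerzog1998, Thm. 3.3.10] -/
theorem ca_subset_caAt_of_completion_ext_eq_zero (T : Subalgebra k K) [IsNoetherianRing ↥T] [IsLocalRing ↥T]
    [IsIntegrallyClosed ↥T] (hT : Algebra.EssFiniteType k ↥T) {d : ℕ} (hd : ringKrullDim ↥T = d)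
    (hisoT : IsIsolatedSingularity ↥T)
    (hGor : ∀ (W : ModuleCat.{u} (AdicCompletion (maximalIdeal ↥T) ↥T)),
      Module.Finite (AdicCompletion (maximalIdeal ↥T) ↥T) W → ∀ i : ℕ, 3 ≤ i →
        ∀ e : Ext.{u} W (ModuleCat.of (AdicCompletion (maximalIdeal ↥T) ↥T)
          (AdicCompletion (maximalIdeal ↥T) ↥T)) i, e = 0)
    {n : ℕ} (hn : 3 ≤ n) :
    {x : K | ∃ hx : x ∈ T, ∃ m : ℕ, ∀ i : ℕ, m ≤ i → ∀ (M N : ModuleCat.{u} ↥T),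
        Module.Finite ↥T M → Module.Finite ↥T N →
          ∀ e : CategoryTheory.Abelian.Ext.{u} M N i, (⟨x, hx⟩ : ↥T) • e = 0} ⊆
      {x : K | ∃ hx : x ∈ T, ∀ i : ℕ, n ≤ i → ∀ (M N : ModuleCat.{u} ↥T),
        Module.Finite ↥T M → Module.Finite ↥T N →
          ∀ e : CategoryTheory.Abelian.Ext.{u} M N i, (⟨x, hx⟩ : ↥T) • e = 0} := by
  haveI := isDomain_adicCompletion_of_isIntegrallyClosed T hT
  have hiso := isIsolatedSingularity_adicCompletion_of_essFiniteType k hT hisoT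
  exact ca_subset_caAt_of_le T
    ((cohomologyAnnihilator_eq_three_of_completion_ext_eq_zero hd hiso hGor).le.trans
      (cohomologyAnnihilatorOfDegree_mono hn))

/-- **`Satₙ` (`n ≥ 3`) at a two-dimensional normal stage whose COMPLETION is presented as a complete intersection**,
route vocabulary: `↥T` normal local, essentially of finite type over `k`, `dim ↥T = 2`, an isolated singularity, and
`e : T̂ ≃+* S ⧸ (f₁,…,f_c)` with `S` regular local of dimension `2 + c`, `fᵢ ∈ 𝔪_S`, `S ⧸ (f)` a domain ⇒ `ca T ⊆ caAt n T`.
This is the form in which the specimen charts of the line card are known (analytic type of the singular points of the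
normalised `ca`-charts). [cite: BahlekehHakimianSalarianTakahashi2015, Thm. 4.5; BrunsHerzog1998, Lemma 3.1.16, Thm. 3.3.10] -/
theorem ca_subset_caAt_of_completion_ringEquiv_ofList (T : Subalgebra k K) [IsNoetherianRing ↥T]
    [IsLocalRing ↥T] [IsIntegrallyClosed ↥T] (hT : Algebra.EssFiniteType k ↥T)
    (hd : ringKrullDim ↥T = (2 : ℕ)) (hisoT : IsIsolatedSingularity ↥T) {S : Type u} [CommRing S]
    [IsRegularLocalRing S] (rs : List S) (hmem : ∀ x ∈ rs, x ∈ maximalIdeal S)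
    (hS : ringKrullDim S = (2 + rs.length : ℕ)) [IsDomain (S ⧸ Ideal.ofList rs)]
    (e : AdicCompletion (maximalIdeal ↥T) ↥T ≃+* S ⧸ Ideal.ofList rs) {n : ℕ} (hn : 3 ≤ n) :
    {x : K | ∃ hx : x ∈ T, ∃ m : ℕ, ∀ i : ℕ, m ≤ i → ∀ (M N : ModuleCat.{u} ↥T),
        Module.Finite ↥T M → Module.Finite ↥T N →
          ∀ e : CategoryTheory.Abelian.Ext.{u} M N i, (⟨x, hx⟩ : ↥T) • e = 0} ⊆
      {x : K | ∃ hx : x ∈ T, ∀ i : ℕ, n ≤ i → ∀ (M N : ModuleCat.{u} ↥T),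
        Module.Finite ↥T M → Module.Finite ↥T N →
          ∀ e : CategoryTheory.Abelian.Ext.{u} M N i, (⟨x, hx⟩ : ↥T) • e = 0} := by
  have hiso := isIsolatedSingularity_adicCompletion_of_essFiniteType k hT hisoT
  exact ca_subset_caAt_of_le T
    ((cohomologyAnnihilator_eq_three_of_completion_ringEquiv_ofList hd hiso rs hmem hS e).le.trans
      (cohomologyAnnihilatorOfDegree_mono hn))

end Stage

end Summit.ResolutionOfSingularities.ResolutionOfSingularities.Theorems.HomologicalConductor.PersistenceSurfaceSaturationCompletionGorenstein

end
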